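import Literature.NumberTheory.Automorphic.Liu2021.Thm418Transport
import HarnessLib

/-!
# [Liu2021, Thm. 4.18] MAIN STATEMENT + item (3) are invariant under isomorphism of the datum

Structural lemma, the MAIN + ITEM-(3) SLICE of ✔ `Thm418Data.thm418AsPrinted_transport` (`Thm418Transport.lean`): if the datum
`D : Thm418Data F E` has the printed main isomorphism `Φ : Ω(μ) ⊗_{M_μ} ℂ ≃ ⊕_{(ε,χ)} ω(μ, ε, χ)` of `ℂ[𝔾(𝔸_F^∞)]`-modules (l. 2233–2237)
TOGETHER WITH item (3) «for every `μ`-admissible `ε` the subspace `⊕_χ ω(μ, ε, χ)` is stable under `Gal(ℂ/M_μ)`» (l. 2243) for that `Φ`, then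
so does every transported datum `D′ = D.transport G′ φ Eps′ epsOf′ Chi′ ω′ ρ′` along an index bijection `e : D′.AdmIndex ≃ D.AdmIndex` lying
over an INJECTIVE map of collections `fε` compatible with admissibility, and summand isomorphisms `ω′_{i′} ≃ₗ[ℂ] ω_{e i′}` intertwining `ρ′(g′)`
with `ρ(φ g′)`.  Needed where the main statement and (3) are moved between two presentations of one datum without items (1), (2) (the
datum of a hermitian space `𝕍` at the label `μᶜ` read along `g ↦ ḡ` versus the conjugate space `𝕍^{(c)}` at `μ`).  The two clauses share the
isomorphism `Φ`, hence travel together.  ONE THEOREM; no `def`, no named fact, no `sorry`; no mathematics of [Liu2021] is asserted.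
Seat prover-hodgecm-mathlib-A-p19 (cell hodgecm-mathlib, fan A, rung A-III, KEY a3-main-galois-glue), 2026-08-28.

References: [Liu2021] Y. Liu, *Fourier–Jacobi cycles and arithmetic relative trace formula*, Camb. J. Math. 9 (2021), Thm. 4.18 main
statement (FJcycle.tex l. 2233–2237) and item (3) (l. 2243), Def. 4.11–4.12.
-/

set_option autoImplicit false

noncomputable section

open NumberField TensorProduct DirectSum

namespace Literature.NumberTheory.Automorphic.Liu2021

namespace Thm418Data

variable {F E : Type} [Field F] [NumberField F] [IsTotallyReal F] [Field E] [NumberField E] [Algebra F E]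
  [IsTotallyComplex E] [Algebra.IsQuadraticExtension F E]

/-- **The main isomorphism + item (3) of [Liu2021, Thm. 4.18] transport.**  For a datum `D` and its transport
`D′ = D.transport G′ φ Eps′ epsOf′ Chi′ ω′ ρ′`, an index bijection `e : D′.AdmIndex ≃ D.AdmIndex` over an injective map of collections `fε`
(`(e i′).ε = fε (i′.ε)`) carrying `D′`-admissible collections to `D`-admissible ones, and summand isomorphisms `Ωᵢ i′ : ω′_{i′} ≃ₗ[ℂ] ω_{e i′}`
intertwining `ρ′(g′)` with `ρ(φ g′)`: if `D` has an isomorphism `Φ : ℂ ⊗_{M_μ} Ω(μ) ≃ ⊕_i ω_i` of `ℂ[𝔾(𝔸_F^∞)]`-modules whose `ε`-blocks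
(`μ`-admissible `ε`) are `Gal(ℂ/M_μ)`-stable, then so has `D′` — the isomorphism `Φ′ x i′ := (Ωᵢ i′)⁻¹ (Φ x (e i′))`.
[cite: Liu2021, Thm. 4.18 main statement (l. 2233–2237) and (3) (l. 2243)] -/
theorem mainGalois_transport (D : Thm418Data F E) (G' : Type) [Group G'] [TopologicalSpace G'] [IsTopologicalGroup G']
    (φ : G' ≃ₜ* D.G) (Eps' : Type) (epsOf' : E → Eps') (Chi' : Type) (omega' : Eps' → Chi' → Type)
    [∀ ε χ, AddCommGroup (omega' ε χ)] [∀ ε χ, Module ℂ (omega' ε χ)]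
    (rho' : ∀ ε χ, Representation ℂ G' (omega' ε χ))
    (e : (D.transport G' φ Eps' epsOf' Chi' omega' rho').AdmIndex ≃ D.AdmIndex)
    (fε : Eps' → D.Eps) (hfε : Function.Injective fε)
    (he : ∀ i' : (D.transport G' φ Eps' epsOf' Chi' omega' rho').AdmIndex, (e i').1.1 = fε i'.1.1)
    (hadm : ∀ ε' : Eps', (D.transport G' φ Eps' epsOf' Chi' omega' rho').IsAdmissible ε' → D.IsAdmissible (fε ε'))
    (Ωᵢ : ∀ i' : (D.transport G' φ Eps' epsOf' Chi' omega' rho').AdmIndex,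
      (D.transport G' φ Eps' epsOf' Chi' omega' rho').omegaAt i' ≃ₗ[ℂ] D.omegaAt (e i'))
    (hΩ : ∀ (i' : (D.transport G' φ Eps' epsOf' Chi' omega' rho').AdmIndex) (g' : G')
      (y : (D.transport G' φ Eps' epsOf' Chi' omega' rho').omegaAt i'),
      Ωᵢ i' ((D.transport G' φ Eps' epsOf' Chi' omega' rho').rhoAt i' g' y) = D.rhoAt (e i') (φ g') (Ωᵢ i' y))
    (h : ∃ Φ : (ℂ ⊗[fieldOfValues E D.μ] D.Ω) ≃ₗ[ℂ] (⨁ i : D.AdmIndex, D.omegaAt i),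
      (∀ (g : D.G) (x : ℂ ⊗[fieldOfValues E D.μ] D.Ω) (i : D.AdmIndex),
          Φ ((D.rhoΩ g).baseChange ℂ x) i = D.rhoAt i g (Φ x i)) ∧
      (∀ ε : D.Eps, D.IsAdmissible ε → ∀ (σ : ℂ ≃ₐ[fieldOfValues E D.μ] ℂ) (x : ℂ ⊗[fieldOfValues E D.μ] D.Ω),
          (∀ i : D.AdmIndex, i.1.1 ≠ ε → Φ x i = 0) → ∀ i : D.AdmIndex, i.1.1 ≠ ε → Φ (D.galoisAct σ x) i = 0)) :
    ∃ Φ' : (ℂ ⊗[fieldOfValues E (D.transport G' φ Eps' epsOf' Chi' omega' rho').μ]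
        (D.transport G' φ Eps' epsOf' Chi' omega' rho').Ω) ≃ₗ[ℂ]
        (⨁ i' : (D.transport G' φ Eps' epsOf' Chi' omega' rho').AdmIndex, (D.transport G' φ Eps' epsOf' Chi' omega' rho').omegaAt i'),
      (∀ (g' : G') (x : ℂ ⊗[fieldOfValues E (D.transport G' φ Eps' epsOf' Chi' omega' rho').μ]
          (D.transport G' φ Eps' epsOf' Chi' omega' rho').Ω) (i' : (D.transport G' φ Eps' epsOf' Chi' omega' rho').AdmIndex),
          Φ' (((D.transport G' φ Eps' epsOf' Chi' omega' rho').rhoΩ g').baseChange ℂ x) i' =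
            (D.transport G' φ Eps' epsOf' Chi' omega' rho').rhoAt i' g' (Φ' x i')) ∧
      (∀ ε' : Eps', (D.transport G' φ Eps' epsOf' Chi' omega' rho').IsAdmissible ε' →
        ∀ (σ : ℂ ≃ₐ[fieldOfValues E (D.transport G' φ Eps' epsOf' Chi' omega' rho').μ] ℂ)
          (x : ℂ ⊗[fieldOfValues E (D.transport G' φ Eps' epsOf' Chi' omega' rho').μ] (D.transport G' φ Eps' epsOf' Chi' omega' rho').Ω),
          (∀ i' : (D.transport G' φ Eps' epsOf' Chi' omega' rho').AdmIndex, i'.1.1 ≠ ε' → Φ' x i' = 0) →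
            ∀ i' : (D.transport G' φ Eps' epsOf' Chi' omega' rho').AdmIndex, i'.1.1 ≠ ε' →
              Φ' ((D.transport G' φ Eps' epsOf' Chi' omega' rho').galoisAct σ x) i' = 0) := by
  obtain ⟨Φ, hmain, h3⟩ := h
  -- inverse equivariance of the summand isomorphisms
  have hΩsymm : ∀ (i' : (D.transport G' φ Eps' epsOf' Chi' omega' rho').AdmIndex) (g' : G') (z : D.omegaAt (e i')),
      (Ωᵢ i').symm (D.rhoAt (e i') (φ g') z) =
        (D.transport G' φ Eps' epsOf' Chi' omega' rho').rhoAt i' g' ((Ωᵢ i').symm z) := by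
    intro i' g' z
    apply (Ωᵢ i').injective
    rw [LinearEquiv.apply_symm_apply, hΩ, LinearEquiv.apply_symm_apply]
  -- the transported isomorphism `Φ′`: `Φ`, reindex by `e`, then `Ωᵢ⁻¹` componentwise
  let R : (⨁ i : D.AdmIndex, D.omegaAt i) ≃ₗ[ℂ]
      ⨁ i' : (D.transport G' φ Eps' epsOf' Chi' omega' rho').AdmIndex, D.omegaAt (e i') :=
    DirectSum.lequivCongrLeft ℂ e.symm
  let C : (⨁ i' : (D.transport G' φ Eps' epsOf' Chi' omega' rho').AdmIndex, D.omegaAt (e i')) ≃ₗ[ℂ]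
      ⨁ i' : (D.transport G' φ Eps' epsOf' Chi' omega' rho').AdmIndex,
        (D.transport G' φ Eps' epsOf' Chi' omega' rho').omegaAt i' :=
    LinearEquiv.ofLinear
      (DirectSum.lmap fun i' => ((Ωᵢ i').symm : D.omegaAt (e i') ≃ₗ[ℂ]
        (D.transport G' φ Eps' epsOf' Chi' omega' rho').omegaAt i').toLinearMap)
      (DirectSum.lmap fun i' => (Ωᵢ i').toLinearMap)
      (by
        apply LinearMap.ext
        intro x
        apply DFinsupp.ext
        intro i'
        simp only [LinearMap.comp_apply, DirectSum.lmap_apply, LinearEquiv.coe_coe, LinearEquiv.symm_apply_apply,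
          LinearMap.id_apply])
      (by
        apply LinearMap.ext
        intro x
        apply DFinsupp.ext
        intro i'
        simp only [LinearMap.comp_apply, DirectSum.lmap_apply, LinearEquiv.coe_coe, LinearEquiv.apply_symm_apply,
          LinearMap.id_apply])
  let Φ' : (ℂ ⊗[fieldOfValues E D.μ] D.Ω) ≃ₗ[ℂ]
      (⨁ i' : (D.transport G' φ Eps' epsOf' Chi' omega' rho').AdmIndex,
        (D.transport G' φ Eps' epsOf' Chi' omega' rho').omegaAt i') := Φ.trans (R.trans C)
  have hΦ' : ∀ (x : ℂ ⊗[fieldOfValues E D.μ] D.Ω) (i' : (D.transport G' φ Eps' epsOf' Chi' omega' rho').AdmIndex),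
      Φ' x i' = (Ωᵢ i').symm (Φ x (e i')) := by
    intro x i'
    show C (R (Φ x)) i' = _
    simp only [C, R, LinearEquiv.ofLinear_apply, DirectSum.lmap_apply, LinearEquiv.coe_coe]
    rfl
  refine ⟨Φ', ?_, ?_⟩
  · -- (main) equivariance along `φ`
    intro g' x i'
    change Φ' ((D.rhoΩ (φ g')).baseChange ℂ x) i' = (D.transport G' φ Eps' epsOf' Chi' omega' rho').rhoAt i' g' (Φ' x i')
    rw [hΦ', hΦ', hmain, hΩsymm]
  · -- (3) Galois stability of the `ε′`-blocks
    intro ε' hε' σ x hx i' hi'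
    have hx0 : ∀ i : D.AdmIndex, i.1.1 ≠ fε ε' → Φ x i = 0 := by
      intro i hi
      obtain ⟨i'', rfl⟩ := e.surjective i
      have hne : i''.1.1 ≠ ε' := by
        intro heq
        apply hi
        rw [he, heq]
      have hz : Φ' x i'' = 0 := hx i'' hne
      rw [hΦ'] at hz
      simpa using hz
    have hne' : (e i').1.1 ≠ fε ε' := by
      rw [he]
      exact fun heq => hi' (hfε heq)
    have key := h3 (fε ε') (hadm ε' hε') σ x hx0 (e i') hne'
    change Φ' (D.galoisAct σ x) i' = 0
    rw [hΦ', key, map_zero]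

end Thm418Data

end Literature.NumberTheory.Automorphic.Liu2021

end
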